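import Mathlib
import Summits.AtomisticToContinuum.HydrodynamicLimit.Theorems.ImplosionDichotomyDenseExcursionPackingAnalyticDerivRecovery

/-!
# `C¹` recovery off the sonic point in the TWO-SCALE weights of `PackingResolventW`
# (crux `DenseExcursion`, stmt-AtomisticToContinuum-12586, line `sonic-cavity-renewal` v8, stub `stub_analyticPackingImplosion`)

Helper file (`--supports stmt-AtomisticToContinuum-12586`, line lead a2, wave-4 worker D1, task (0): the closure of the
majorant scheme under the weaker linear input `PackingResolventW`). The landed recovery `derivRecovery_pointwise` /
`derivRecovery_offSonic` pays one power of `Λ = kμ` on the UNWEIGHTED size `|u₁| + |u₂|/S`; under `PackingResolventW`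
only the `(1 + S)`-weighted size `|u₁|/(1 + S) + |u₂|/S` gains `1/k` (the `w`-component does not gain in the acoustic
layer at the centre), so that recovery would lose a factor `k` on `|u₁′|`. Kernel-checked here, the REFINED recovery in
which the power of `Λ` multiplies only the weighted size, the unweighted `|u₁|` entering with an `O(1)` coefficient:

* `derivRecovery_pointwise_weighted` (REGISTERED helper): at a point with `S > 0`, `|W|, |W′|, |S′/S|, |S(S′+S)| ≤ A`,
  `1 + S² ≤ K|Δ|`, every solution of the two resolvent equations satisfies
  `|u₁′| + (1 + S)|(u₂/S)′| ≤ (4A + 10) K (A² + 10A + r + 3) · ((|Λ| + 1)(|u₁|/(1+S) + |u₂|/S) + |u₁| + |f₁|/(1+S) + |f₂|/S)`.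
  Mechanism (Cramer, `Δ ≈ −S²` at the centre): in `u₁′ = [(W−1)R₁ − 3S²R₂]/Δ` the term `Λu₁ ∈ R₁` carries the factor
  `(W−1)/Δ = O(1/(1+S²))`, and `R₂ ∋ Λ·(u₂/S)` (weighted, gains) `+ (S′/S + 2)u₁` (unweighted, coefficient `O(1)`); in
  `(1+S)(u₂/S)′ = (1+S)[(W−1)R₂ − R₁/3]/Δ` the term `Λu₁/Δ` is `O(Λ|u₁|/(1+S)²)`. The weight `(1 + S)` (not `1 + S²`) on
  `(u₂/S)′` is exactly what the `s`-source `Src_s/S ∋ w_i (s_j/S)′` and the `(1+S)`-weighted `w`-source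
  `Src_w/(1+S) ∋ 3S²(s_i/S)(s_j/S)′/(1+S)` of the hierarchy consume (`packingSources_bound_weighted`, `ω = 1/(1+S)`);
* `derivRecovery_offSonic_weighted`: the same with ONE existential constant at every `|x| ≥ ρ₁` for a monatomic
  cavity-tube profile (`core_envelope` on `x ≤ 1`, `far_envelope` on `x ≥ 1`).

Worker numerics (`work/stubs/numD1/sizes.py`, full pinned profile, `Λ = 10 … 80`): for inner-scale sources
`sup|u₁′|` and `sup(1+S)|(u₂/S)′|` are `Λ`-INDEPENDENT (1.34–1.38 and 0.33–0.45 for `s`-sources of weighted size 1;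
0.35–0.46 and 0.24–0.35 for `w`-sources of weighted size 1 and unweighted size `≍ 0.55Λ`), while `sup(1+S²)|(u₂/S)′|`
grows like `Λ·sup|u₁|/3` — the one `k`-lossy size, measured separately by `derivRecovery_offSonic`.
Pure real algebra + the landed envelopes. NOT here: the sonic window, norms, or `Γ`.
-/

noncomputable section

open Set

namespace Summit.AtomisticToContinuum.HydrodynamicLimit.Theorems.PackingAnalyticImplosion

open Summit.AtomisticToContinuum.HydrodynamicLimit.Theorems.R2OneModeTwoConditions
open Summit.AtomisticToContinuum.HydrodynamicLimit.Theorems.SonicCavityRenewal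

/-! ## The pointwise weighted recovery -/

-- adapted from `derivRecovery_pointwise` (…PackingAnalyticDerivRecoveryPointwise): same Cramer solve, weighted sizes
set_option maxHeartbeats 800000 in -- one declaration: many `linarith`/`field_simp` steps in one pointwise estimate
/-- **WEIGHTED `C¹` RECOVERY OFF THE SONIC POINT, POINTWISE** (registered helper `derivRecovery_pointwise_weighted` of
`stub_analyticPackingImplosion`): at a point with `S > 0`, `|W|, |W′|, |S′/S|, |S(S′ + S)| ≤ A`, `1 + S² ≤ K|Δ|`
(`Δ = (W−1)² − S²`), every solution `(u₁, u₂)` of the two resolvent equations `Λu − Lu = f` satisfies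
`|u₁′| + (1 + S)|(u₂′S − u₂S′)/S²| ≤ (4A + 10)K(A² + 10A + r + 3)((|Λ| + 1)(|u₁|/(1+S) + |u₂|/S) + |u₁| +
(|f₁|/(1+S) + |f₂|/S))`. [folklore] -/
theorem derivRecovery_pointwise_weighted : ∀ (r W W' S S' Λ u₁ u₁' u₂ u₂' f₁ f₂ A K : ℝ), 0 < S → 0 ≤ r → |W| ≤ A → |W'| ≤ A → |S' / S| ≤ A → |S * (S' + S)| ≤ A → 1 + S ^ 2 ≤ K * |(W - 1) ^ 2 - S ^ 2| → Λ * u₁ - ((W - 1) * u₁' + 3 * S * u₂' + (W' + 2 * W - r) * u₁ + (3 * S' + 6 * S) * u₂) = f₁ → Λ * u₂ - (S / 3 * u₁' + (W - 1) * u₂' + (S' + 2 * S) * u₁ + (W' / 3 + 2 * W - r) * u₂) = f₂ → |u₁'| + (1 + S) * |(u₂' * S - u₂ * S') / S ^ 2| ≤ (4 * A + 10) * K * (A ^ 2 + 10 * A + r + 3) * ((|Λ| + 1) * (|u₁| / (1 + S) + |u₂| / S) + |u₁| + (|f₁| / (1 + S) + |f₂| / S)) := by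
  intro r W W' S S' Λ u₁ u₁' u₂ u₂' f₁ f₂ A K hS hr hW hW' hσ hπ hK h1 h2
  have hS0 : S ≠ 0 := hS.ne'
  have hS1 : 0 < 1 + S := by linarith
  have hA0 : 0 ≤ A := (abs_nonneg W).trans hW
  -- the relative perturbation and its derivative (opaque names with defining equations)
  obtain ⟨v, hv⟩ : ∃ v : ℝ, v = u₂ / S := ⟨_, rfl⟩
  obtain ⟨v', hv'⟩ : ∃ v' : ℝ, v' = (u₂' * S - u₂ * S') / S ^ 2 := ⟨_, rfl⟩
  have hu₂ : u₂ = S * v := by rw [hv]; field_simp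
  have hu₂' : u₂' = S * v' + S' * v := by rw [hv', hv]; field_simp; ring
  have habsv : |v| = |u₂| / S := by rw [hv, abs_div, abs_of_pos hS]
  -- the determinant
  obtain ⟨Δ, hΔ⟩ : ∃ Δ : ℝ, Δ = (W - 1) ^ 2 - S ^ 2 := ⟨_, rfl⟩
  rw [← hΔ] at hK
  have hΔpos : 0 < |Δ| := by
    by_contra hle
    push Not at hle
    have hΔabs : |Δ| = 0 := le_antisymm hle (abs_nonneg _)
    rw [hΔabs, mul_zero] at hK
    nlinarith [sq_nonneg S]
  have hΔ0 : Δ ≠ 0 := abs_pos.mp hΔpos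
  have hKpos : 0 < K := by
    by_contra hneg
    push Not at hneg
    have h' : K * |Δ| ≤ 0 := mul_nonpos_of_nonpos_of_nonneg hneg hΔpos.le
    nlinarith [sq_nonneg S]
  -- the right-hand sides
  obtain ⟨σ, hσdef⟩ : ∃ σ : ℝ, σ = S' / S := ⟨_, rfl⟩
  rw [← hσdef] at hσ
  have hS' : S' = S * σ := by rw [hσdef]; field_simp
  obtain ⟨π, hπdef⟩ : ∃ π : ℝ, π = S * (S' + S) := ⟨_, rfl⟩
  rw [← hπdef] at hπ
  obtain ⟨R₁, hR₁⟩ : ∃ R₁ : ℝ, R₁ = Λ * u₁ - (W' + 2 * W - r) * u₁ - 6 * π * v - f₁ := ⟨_, rfl⟩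
  obtain ⟨R₂, hR₂⟩ : ∃ R₂ : ℝ, R₂ = Λ * v - (σ + 2) * u₁ - (W' / 3 + 2 * W - r + (W - 1) * σ) * v - f₂ / S := ⟨_, rfl⟩
  -- the first-order system in `(u₁′, v′)`
  have e1 : (W - 1) * u₁' + 3 * S ^ 2 * v' = R₁ := by
    rw [hR₁, hπdef, ← h1, hu₂', hu₂]; ring
  have e2 : 1 / 3 * u₁' + (W - 1) * v' = R₂ := by
    have h2' : Λ * (S * v) - (S / 3 * u₁' + (W - 1) * (S * v' + S' * v) + (S' + 2 * S) * u₁ +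
        (W' / 3 + 2 * W - r) * (S * v)) = f₂ := by rw [← hu₂, ← hu₂']; exact h2
    rw [hS'] at h2'
    have hSR : S * (f₂ / S) = f₂ := by field_simp
    have hmul : S * (1 / 3 * u₁' + (W - 1) * v') = S * R₂ := by
      rw [hR₂]
      linear_combination (-1 : ℝ) * h2' + hSR
    exact mul_left_cancel₀ hS0 hmul
  -- Cramer's rule
  have cu : u₁' = ((W - 1) * R₁ - 3 * S ^ 2 * R₂) / Δ := by
    rw [eq_div_iff hΔ0, ← e1, ← e2, hΔ]; ring
  have cv : v' = ((W - 1) * R₂ - R₁ / 3) / Δ := by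
    rw [eq_div_iff hΔ0, ← e1, ← e2, hΔ]; ring
  -- sizes: `a = |u₁|/(1+S)`, `b = |v|`, `c = |u₁|`, `mw = |f₁|/(1+S)`, `ms = |f₂|/S`, `L = A² + 10A + r + 3`
  obtain ⟨L, hLdef⟩ : ∃ L : ℝ, L = A ^ 2 + 10 * A + r + 3 := ⟨_, rfl⟩
  have hL1 : 1 ≤ L := by rw [hLdef]; nlinarith
  obtain ⟨a, hadef⟩ : ∃ a : ℝ, a = |u₁| / (1 + S) := ⟨_, rfl⟩
  obtain ⟨c, hcdef⟩ : ∃ c : ℝ, c = |u₁| := ⟨_, rfl⟩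
  obtain ⟨mw, hmwdef⟩ : ∃ mw : ℝ, mw = |f₁| / (1 + S) := ⟨_, rfl⟩
  obtain ⟨ms, hmsdef⟩ : ∃ ms : ℝ, ms = |f₂| / S := ⟨_, rfl⟩
  have ha0 : 0 ≤ a := by rw [hadef]; positivity
  have hc0 : 0 ≤ c := by rw [hcdef]; positivity
  have hb0 : 0 ≤ |v| := abs_nonneg v
  have hmw0 : 0 ≤ mw := by rw [hmwdef]; positivity
  have hms0 : 0 ≤ ms := by rw [hmsdef]; positivity
  have hca : c = (1 + S) * a := by rw [hadef, hcdef]; field_simp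
  have hf₁ : |f₁| = (1 + S) * mw := by rw [hmwdef]; field_simp
  have hf₂S : |f₂ / S| = ms := by rw [hmsdef, abs_div, abs_of_pos hS]
  obtain ⟨Q, hQdef⟩ : ∃ Q : ℝ, Q = (|Λ| + 1) * (a + |v|) + c + (mw + ms) := ⟨_, rfl⟩
  have hQ0 : 0 ≤ Q := by rw [hQdef]; positivity
  have hW1 : |W - 1| ≤ A + 1 := by
    calc |W - 1| ≤ |W| + |1| := abs_sub _ _
      _ ≤ A + 1 := by rw [abs_one]; linarith
  -- |R₁| ≤ (1 + S) L Q  (the power of `Λ` on the weighted size only)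
  have hR₁b : |R₁| ≤ (1 + S) * (L * Q) := by
    have t1 := mul_mem_bounds (le_refl |Λ|) u₁
    have t2 := mul_mem_bounds hW' u₁
    have t3 := mul_mem_bounds hW u₁
    have t4 := mul_mem_bounds hπ v
    have hru1 : r * u₁ ≤ r * |u₁| := mul_le_mul_of_nonneg_left (le_abs_self u₁) hr
    have hru2 : r * (-|u₁|) ≤ r * u₁ := mul_le_mul_of_nonneg_left (neg_abs_le u₁) hr
    have hf := abs_le.mp (le_refl |f₁|)
    have e : R₁ = Λ * u₁ - W' * u₁ - 2 * (W * u₁) + r * u₁ - 6 * (π * v) - f₁ := by rw [hR₁]; ring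
    have hnat : |R₁| ≤ (|Λ| + 3 * A + r) * |u₁| + 6 * A * |v| + |f₁| := by
      rw [abs_le, e]
      constructor
      · linarith only [t1.1, t2.2, t3.2, t4.2, hru2, hf.2]
      · linarith only [t1.2, t2.1, t3.1, t4.1, hru1, hf.1]
    rw [← hcdef, hca, hf₁] at hnat
    have hgap : (|Λ| + 3 * A + r) * ((1 + S) * a) + 6 * A * |v| + (1 + S) * mw ≤ (1 + S) * (L * Q) := by
      rw [hQdef]
      have g1 : 0 ≤ (L - 1) * (|Λ| * ((1 + S) * a)) := mul_nonneg (by linarith only [hL1]) (by positivity)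
      have g2 : 0 ≤ (L - 3 * A - r) * ((1 + S) * a) :=
        mul_nonneg (by rw [hLdef]; nlinarith only [hA0, sq_nonneg A]) (by positivity)
      have g3 : 6 * A * |v| ≤ (1 + S) * (L * |v|) := by
        have h6 : 6 * A ≤ L := by rw [hLdef]; nlinarith only [hA0, sq_nonneg A, hr]
        have h7 : 6 * A * |v| ≤ L * |v| := mul_le_mul_of_nonneg_right h6 hb0
        have h8 : L * |v| ≤ (1 + S) * (L * |v|) :=
          le_mul_of_one_le_left (mul_nonneg (by linarith only [hL1]) hb0) (by linarith only [hS])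
        exact h7.trans h8
      have g4 : 0 ≤ (L - 1) * ((1 + S) * mw) := mul_nonneg (by linarith only [hL1]) (by positivity)
      have g5 : 0 ≤ (1 + S) * (L * (|Λ| * |v| + c + ms)) :=
        mul_nonneg hS1.le (mul_nonneg (by linarith only [hL1]) (by positivity))
      linarith only [g1, g2, g3, g4, g5]
    exact hnat.trans hgap
  -- |R₂| ≤ L Q
  have hR₂b : |R₂| ≤ L * Q := by
    have t1 := mul_mem_bounds (le_refl |Λ|) v
    have t2 := mul_mem_bounds hσ u₁
    have t3 := mul_mem_bounds hW' v
    have t4 := mul_mem_bounds hW v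
    have t5 := mul_mem_bounds hW1 (σ * v)
    have t5' : |σ * v| ≤ A * |v| := abs_mul_le_of_abs_le hσ v
    have hu1 : u₁ ≤ |u₁| := le_abs_self u₁
    have hu2 : -|u₁| ≤ u₁ := neg_abs_le u₁
    have hrv1 : r * v ≤ r * |v| := mul_le_mul_of_nonneg_left (le_abs_self v) hr
    have hrv2 : r * (-|v|) ≤ r * v := mul_le_mul_of_nonneg_left (neg_abs_le v) hr
    have hf := abs_le.mp (le_refl |f₂ / S|)
    rw [hf₂S] at hf
    have e : R₂ = Λ * v - σ * u₁ - 2 * u₁ - 1 / 3 * (W' * v) - 2 * (W * v) + r * v - (W - 1) * (σ * v) - f₂ / S := by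
      rw [hR₂]; ring
    have hAv : (A + 1) * |σ * v| ≤ (A + 1) * (A * |v|) := mul_le_mul_of_nonneg_left t5' (by linarith)
    have hnat : |R₂| ≤ |Λ| * |v| + (A + 2) * |u₁| + (A / 3 + 2 * A + r + (A + 1) * A) * |v| + ms := by
      rw [abs_le, e]
      constructor
      · linarith only [t1.1, t2.2, t3.2, t4.2, t5.2, hu1, hrv2, hAv, hf.2]
      · linarith only [t1.2, t2.1, t3.1, t4.1, t5.1, hu2, hrv1, hAv, hf.1]
    rw [← hcdef] at hnat
    have hgap : |Λ| * |v| + (A + 2) * c + (A / 3 + 2 * A + r + (A + 1) * A) * |v| + ms ≤ L * Q := by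
      rw [hQdef, hLdef]
      have g1 : 0 ≤ (A ^ 2 + 10 * A + r + 3 - 1) * (|Λ| * |v|) :=
        mul_nonneg (by nlinarith only [hA0, hr, sq_nonneg A]) (by positivity)
      have g2 : 0 ≤ (A ^ 2 + 10 * A + r + 3 - (A + 2)) * c :=
        mul_nonneg (by nlinarith only [hA0, hr, sq_nonneg A]) hc0
      have g3 : 0 ≤ (A ^ 2 + 10 * A + r + 3 - (A / 3 + 2 * A + r + (A + 1) * A)) * |v| :=
        mul_nonneg (by nlinarith only [hA0, hr, sq_nonneg A]) hb0
      have g4 : 0 ≤ (A ^ 2 + 10 * A + r + 3 - 1) * ms := mul_nonneg (by nlinarith only [hA0, hr, sq_nonneg A]) hms0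
      have g5 : 0 ≤ (A ^ 2 + 10 * A + r + 3) * ((|Λ| + 1) * a + mw) :=
        mul_nonneg (by nlinarith only [hA0, hr, sq_nonneg A]) (by positivity)
      linarith only [g1, g2, g3, g4, g5]
    exact hnat.trans hgap
  -- `1/|Δ| ≤ K/(1 + S²)` and the two weight inequalities
  have hΔinv : ∀ y : ℝ, 0 ≤ y → y / |Δ| ≤ K * y / (1 + S ^ 2) := by
    intro y hy
    rw [div_le_div_iff₀ hΔpos (by positivity)]
    calc y * (1 + S ^ 2) ≤ y * (K * |Δ|) := mul_le_mul_of_nonneg_left hK hy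
      _ = K * y * |Δ| := by ring
  have hw1 : (1 + S) ≤ 2 * (1 + S ^ 2) := by nlinarith only [sq_nonneg (2 * S - 1), hS]
  have hw2 : (1 + S) ^ 2 ≤ 2 * (1 + S ^ 2) := by nlinarith only [sq_nonneg (S - 1)]
  have hw3 : S ^ 2 ≤ 1 + S ^ 2 := by linarith
  have hLQ0 : 0 ≤ L * Q := mul_nonneg (by linarith only [hL1]) hQ0
  -- the derivatives through Cramer
  have hu₁'b : |u₁'| ≤ K * ((A + 1) * (1 + S) * (L * Q) + 3 * S ^ 2 * (L * Q)) / (1 + S ^ 2) := by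
    have h0 : |u₁'| ≤ ((A + 1) * (1 + S) * (L * Q) + 3 * S ^ 2 * (L * Q)) / |Δ| := by
      rw [cu, abs_div, div_le_div_iff_of_pos_right hΔpos]
      calc |(W - 1) * R₁ - 3 * S ^ 2 * R₂| ≤ |(W - 1) * R₁| + |3 * S ^ 2 * R₂| := abs_sub _ _
        _ = |W - 1| * |R₁| + 3 * S ^ 2 * |R₂| := by
            rw [abs_mul, abs_mul, abs_of_nonneg (by positivity : (0:ℝ) ≤ 3 * S ^ 2)]
        _ ≤ (A + 1) * ((1 + S) * (L * Q)) + 3 * S ^ 2 * (L * Q) := by gcongr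
        _ = (A + 1) * (1 + S) * (L * Q) + 3 * S ^ 2 * (L * Q) := by ring
    exact h0.trans (hΔinv _ (by positivity))
  have hv'b : (1 + S) * |v'| ≤ K * ((1 + S) * ((A + 1) * (L * Q) + (1 + S) * (L * Q) / 3)) / (1 + S ^ 2) := by
    have h0 : |v'| ≤ ((A + 1) * (L * Q) + (1 + S) * (L * Q) / 3) / |Δ| := by
      rw [cv, abs_div, div_le_div_iff_of_pos_right hΔpos]
      calc |(W - 1) * R₂ - R₁ / 3| ≤ |(W - 1) * R₂| + |R₁ / 3| := abs_sub _ _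
        _ = |W - 1| * |R₂| + |R₁| / 3 := by rw [abs_mul, abs_div, abs_of_pos (by norm_num : (0:ℝ) < 3)]
        _ ≤ (A + 1) * (L * Q) + (1 + S) * (L * Q) / 3 := by gcongr
    have h3 := mul_le_mul_of_nonneg_left (h0.trans (hΔinv _ (by positivity))) hS1.le
    calc (1 + S) * |v'| ≤ (1 + S) * (K * ((A + 1) * (L * Q) + (1 + S) * (L * Q) / 3) / (1 + S ^ 2)) := h3
      _ = K * ((1 + S) * ((A + 1) * (L * Q) + (1 + S) * (L * Q) / 3)) / (1 + S ^ 2) := by ring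
  -- assemble
  have hv'eq : |(u₂' * S - u₂ * S') / S ^ 2| = |v'| := by rw [hv']
  rw [hv'eq, ← habsv, ← hadef, ← hcdef, ← hmwdef, ← hmsdef, ← hQdef, ← hLdef]
  have hsum : |u₁'| + (1 + S) * |v'| ≤ K * ((A + 1) * (1 + S) * (L * Q) + 3 * S ^ 2 * (L * Q) +
      (1 + S) * ((A + 1) * (L * Q) + (1 + S) * (L * Q) / 3)) / (1 + S ^ 2) := by
    rw [mul_add K, add_div]
    exact add_le_add hu₁'b hv'b
  refine hsum.trans ?_
  rw [div_le_iff₀ (by positivity : (0:ℝ) < 1 + S ^ 2)]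
  have hkey : (A + 1) * (1 + S) * (L * Q) + 3 * S ^ 2 * (L * Q) +
      (1 + S) * ((A + 1) * (L * Q) + (1 + S) * (L * Q) / 3) ≤ (4 * A + 10) * (L * Q) * (1 + S ^ 2) := by
    have g1 : (A + 1) * (1 + S) * (L * Q) ≤ (A + 1) * (2 * (1 + S ^ 2)) * (L * Q) := by
      apply mul_le_mul_of_nonneg_right _ hLQ0
      exact mul_le_mul_of_nonneg_left hw1 (by linarith only [hA0])
    have g2 : 3 * S ^ 2 * (L * Q) ≤ 3 * (1 + S ^ 2) * (L * Q) :=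
      mul_le_mul_of_nonneg_right (by linarith only [hw3]) hLQ0
    have g3 : (1 + S) * ((1 + S) * (L * Q) / 3) ≤ 2 * (1 + S ^ 2) * (L * Q) / 3 := by
      have : (1 + S) * ((1 + S) * (L * Q) / 3) = (1 + S) ^ 2 * (L * Q) / 3 := by ring
      rw [this, div_le_div_iff_of_pos_right (by norm_num : (0:ℝ) < 3)]
      exact mul_le_mul_of_nonneg_right hw2 hLQ0
    have g4 : (1 + S) * ((A + 1) * (L * Q)) ≤ 2 * (1 + S ^ 2) * ((A + 1) * (L * Q)) :=
      mul_le_mul_of_nonneg_right hw1 (mul_nonneg (by linarith only [hA0]) hLQ0)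
    have g5 : 0 ≤ (1 + S ^ 2) * (L * Q) := by positivity
    linarith only [g1, g2, g3, g4, g5]
  calc K * ((A + 1) * (1 + S) * (L * Q) + 3 * S ^ 2 * (L * Q) +
        (1 + S) * ((A + 1) * (L * Q) + (1 + S) * (L * Q) / 3))
      ≤ K * ((4 * A + 10) * (L * Q) * (1 + S ^ 2)) := mul_le_mul_of_nonneg_left hkey hKpos.le
    _ = (4 * A + 10) * K * L * Q * (1 + S ^ 2) := by ring

/-! ## The assembly off the sonic window -/

-- adapted from `derivRecovery_offSonic` (…PackingAnalyticDerivRecovery): same envelopes, weighted pointwise lemma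
/-- **WEIGHTED `C¹` RECOVERY OFF THE SONIC WINDOW**: for `0 < ρ₁ ≤ 1` and a monatomic cavity-tube profile there is ONE
constant `C` such that, at every point `|x| ≥ ρ₁` and for every real `Λ`, every real solution of the two resolvent
equations `Λu − Lu = f` (real form) satisfies
`|u₁′| + (1 + S)|(u₂/S)′| ≤ C((|Λ| + 1)(|u₁|/(1+S) + |u₂|/S) + |u₁| + |f₁|/(1+S) + |f₂|/S)`. [folklore] -/
theorem derivRecovery_offSonic_weighted : ∀ (r : ℝ) (W S : ℝ → ℝ) (ρ₁ : ℝ), 0 < ρ₁ → ρ₁ ≤ 1 → IsMonatomicProfile r W S → CavityTube r W S → ∃ C : ℝ, 0 < C ∧ ∀ (Λ : ℝ) (u₁ u₂ f₁ f₂ : ℝ → ℝ) (x : ℝ), ρ₁ ≤ |x| → DifferentiableAt ℝ u₂ x → Λ * u₁ x - ((W x - 1) * deriv u₁ x + 3 * S x * deriv u₂ x + (deriv W x + 2 * W x - r) * u₁ x + (3 * deriv S x + 6 * S x) * u₂ x) = f₁ x → Λ * u₂ x - (S x / 3 * deriv u₁ x + (W x - 1) * deriv u₂ x + (deriv S x +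 2 * S x) * u₁ x + (deriv W x / 3 + 2 * W x - r) * u₂ x) = f₂ x → |deriv u₁ x| + (1 + S x) * |deriv (fun y => u₂ y / S y) x| ≤ C * ((|Λ| + 1) * (|u₁ x| / (1 + S x) + |u₂ x| / S x) + |u₁ x| + (|f₁ x| / (1 + S x) + |f₂ x| / S x)) := by
  intro r W S ρ₁ hρ₁ hρ₁1 hP hT
  have hr : 0 ≤ r := by linarith [hP.1]
  have hSpos : ∀ x, 0 < S x := hP.2.2.2.2.1
  have hSd : Differentiable ℝ S := hP.2.2.2.1.differentiable (by simp)
  have hsub : ∀ x, 0 < x → W x + S x < 1 := hT.2.2.1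
  obtain ⟨A₂, K₂, hfar⟩ := far_envelope hP hsub
  -- common constants
  set A : ℝ := max 3 A₂ with hAdef
  set K : ℝ := max (40 / ρ₁) K₂ with hKdef
  have hA3 : 3 ≤ A := le_max_left _ _
  have hK40 : 40 / ρ₁ ≤ K := le_max_left _ _
  have hKpos : 0 < K := lt_of_lt_of_le (by positivity) hK40
  have henv : ∀ x, ρ₁ ≤ |x| → |W x| ≤ A ∧ |deriv W x| ≤ A ∧ |deriv S x / S x| ≤ A ∧
      |S x * (deriv S x + S x)| ≤ A ∧ 1 + S x ^ 2 ≤ K * |(W x - 1) ^ 2 - S x ^ 2| := by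
    intro x hx
    rcases le_or_gt x 1 with hx1 | hx1
    · obtain ⟨h1, h2, h3, h4, h5⟩ := core_envelope r W S ρ₁ hρ₁ hρ₁1 hSpos hSd hT x hx1 hx
      exact ⟨h1.trans hA3, h2.trans hA3, h3.trans hA3, h4.trans hA3,
        h5.trans (mul_le_mul_of_nonneg_right hK40 (abs_nonneg _))⟩
    · obtain ⟨h1, h2, h3, h4, h5⟩ := hfar x hx1.le
      exact ⟨h1.trans (le_max_right _ _), h2.trans (le_max_right _ _), h3.trans (le_max_right _ _),
        h4.trans (le_max_right _ _), h5.trans (mul_le_mul_of_nonneg_right (le_max_right _ _) (abs_nonneg _))⟩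
  have hCpos : 0 < (4 * A + 10) * K * (A ^ 2 + 10 * A + r + 3) :=
    mul_pos (mul_pos (by linarith) hKpos) (by nlinarith)
  refine ⟨(4 * A + 10) * K * (A ^ 2 + 10 * A + r + 3), hCpos, ?_⟩
  intro Λ u₁ u₂ f₁ f₂ x hx hu₂ h1 h2
  obtain ⟨eW, eW', eσ, eπ, eK⟩ := henv x hx
  have hS := hSpos x
  -- the derivative of the quotient
  have hq : deriv (fun y => u₂ y / S y) x = (deriv u₂ x * S x - u₂ x * deriv S x) / S x ^ 2 :=
    (hu₂.hasDerivAt.div (hSd x).hasDerivAt hS.ne').deriv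
  rw [hq]
  exact derivRecovery_pointwise_weighted r (W x) (deriv W x) (S x) (deriv S x) Λ (u₁ x) (deriv u₁ x) (u₂ x)
    (deriv u₂ x) (f₁ x) (f₂ x) A K hS hr eW eW' eσ eπ eK h1 h2

end Summit.AtomisticToContinuum.HydrodynamicLimit.Theorems.PackingAnalyticImplosion

end
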